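import Literature.NumberTheory.Sieve.CFSemigroupLogLipschitz
import HarnessLib

/-!
# The complex transfer operators `L_s` (`s ∈ ℂ`) of `Γ_A`: domination and Lasota–Yorke bounds

Support file (all results proved) for the named fact
`Literature.NumberTheory.Sieve.MageeOhWinter2019_uniformCounting` (`CFSemigroupCounting.lean`).
The renewal/Laplace-transform analysis of [MageeOhWinter2019, §3] (and the spectral bounds of
Thm. 4, §§4–5) concern the transfer operators `L_s`, `s = σ + it ∈ ℂ`,
`(L_s f)(x) = Σ_{a ∈ A} (x + a)^{-2s} f(1/(x + a))` acting on (`ℂ`-valued) `C¹`/Lipschitz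
functions on `I = [0,1]`. This file sets up `L_s` for complex `s` (`cfLC`) on functions
`ℝ → ℂ` (only the values on `[0,1]` matter) and proves the two a priori estimates on which all
later spectral theory rests (Naud, Prop. 5.x; [MageeOhWinter2019, §2.2, §3.3]):

* `cfLC_iterate`: the iterates are word sums `L_sⁿ f (x) = Σ_{w ∈ Aⁿ} denom(M_w, x)^{-2s} f(M_w x)`
  (cocycle `cfWt_mul` of the complex weights `cfWt s M x = exp(-2 s log denom(M, x))`);
* `norm_cfLC_iterate_le`: **domination** `‖L_sⁿ f (x)‖ ≤ (L_σⁿ ‖f‖)(x)`, `σ = Re s`, hence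
  `‖L_sⁿ f‖_∞ ≤ 4^σ e^{nP_A(σ)} ‖f‖_∞` (`norm_cfLC_iterate_le_of_bound`);
* `norm_cfLC_iterate_sub_le`: the **Lasota–Yorke inequality**
  `‖L_sⁿ f (x) - L_sⁿ f (y)‖ ≤ (L_σⁿ 1)(y) (4 ‖s‖ e^{2σ} ‖f‖_∞ + 2^{1-n} Lip(f)) |x - y|` on
  `[0,1]` (bounded distortion of the weights, `norm_cfWt_sub_cfWt_le`, and contraction of the
  branches, `abs_cfMoeb_sub_le_geom`);
* `cfLC_ofReal`, `cfLC_iterate_ofReal`: for real `s` and real `f`, `L_s` is the real transfer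
  operator `cfTransfer` of `CFSemigroupTransfer.lean`;
* `hasDerivAt_cfLCSum`: `s ↦ L_sⁿ f (x)` is entire, with derivative the word sum weighted by
  `-2 log denom(M_w, x)` (`cfLCSumD`).

## References

* M. Magee, H. Oh, D. Winter, J. reine angew. Math. 753 (2019) 89–135, §2.2, §3.3.
  [MageeOhWinter2019]
* F. Naud, Ann. Sci. ÉNS 38 (2005) 116–153, §5 (a priori bounds for `L_s` on `C¹(I)`).
-/

noncomputable section

open Filter Set
open scoped Topology

namespace Literature.NumberTheory.Sieve

variable {A : Finset ℕ} {n : ℕ}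

/-! ### Complex weights -/

/-- The complex weight `denom(M, x)^{-2s} = exp(-2 s log denom(M, x))`.
[cite: MageeOhWinter2019, §2.2] -/
def cfWt (s : ℂ) (M : Matrix (Fin 2) (Fin 2) ℤ) (x : ℝ) : ℂ :=
  Complex.exp (-(2 * s * (Real.log (cfDenom M x) : ℂ)))

/-- The real part of the exponent. [folklore] -/
theorem cfWt_exponent_re (s : ℂ) (M : Matrix (Fin 2) (Fin 2) ℤ) (x : ℝ) :
    (-(2 * s * (Real.log (cfDenom M x) : ℂ))).re = -(2 * s.re * Real.log (cfDenom M x)) := by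
  simp only [Complex.neg_re, Complex.mul_re, Complex.mul_im, Complex.ofReal_re, Complex.ofReal_im,
    Complex.re_ofNat, Complex.im_ofNat]
  ring

/-- `‖denom(M,x)^{-2s}‖ = (denom(M,x)²)^{-Re s}`. [folklore] -/
theorem norm_cfWt (s : ℂ) (M : Matrix (Fin 2) (Fin 2) ℤ) {x : ℝ} (hd : 0 < cfDenom M x) :
    ‖cfWt s M x‖ = ((cfDenom M x) ^ 2) ^ (-s.re) := by
  rw [cfWt, Complex.norm_exp, cfWt_exponent_re, Real.rpow_def_of_pos (pow_pos hd 2), Real.log_pow]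
  congr 1
  push_cast
  ring

/-- For real `s` the complex weight is the real weight `(denom(M,x)²)^{-s}`. [folklore] -/
theorem cfWt_ofReal (σ : ℝ) (M : Matrix (Fin 2) (Fin 2) ℤ) {x : ℝ} (hd : 0 < cfDenom M x) :
    cfWt (σ : ℂ) M x = ((((cfDenom M x) ^ 2) ^ (-σ) : ℝ) : ℂ) := by
  rw [cfWt]
  have h : (-(2 * (σ : ℂ) * (Real.log (cfDenom M x) : ℂ))) = ((-(2 * σ * Real.log (cfDenom M x)) : ℝ) : ℂ) := by
    push_cast; ring
  rw [h, ← Complex.ofReal_exp, Real.rpow_def_of_pos (pow_pos hd 2), Real.log_pow]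
  congr 2
  push_cast
  ring

/-- **The weights form a cocycle:** `wt_s(M N, x) = wt_s(N, x) wt_s(M, N x)` (chain rule), when the
denominators are positive. [folklore] -/
theorem cfWt_mul (s : ℂ) (M N : Matrix (Fin 2) (Fin 2) ℤ) {x : ℝ} (hN : 0 < cfDenom N x)
    (hM : 0 < cfDenom M (cfMoeb N x)) : cfWt s (M * N) x = cfWt s N x * cfWt s M (cfMoeb N x) := by
  rw [cfWt, cfWt, cfWt, cfDenom_mul M N hN.ne', Real.log_mul hN.ne' hM.ne', ← Complex.exp_add]
  congr 1
  push_cast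
  ring

/-- The weight of the generator: `wt_s(g_a, x) = exp(-2 s log(x + a))`. [folklore] -/
theorem cfWt_cfGen (s : ℂ) (a : ℕ) (x : ℝ) :
    cfWt s (cfGen a) x = Complex.exp (-(2 * s * (Real.log (x + a) : ℂ))) := by
  rw [cfWt, cfDenom_cfGen]

/-! ### The complex transfer operator and its iterates -/

variable (A) in
/-- **The transfer operator `L_s` for complex `s`:**
`(L_s f)(x) = Σ_{a ∈ A} (x + a)^{-2s} f(1/(x + a))` on functions `ℝ → ℂ`.
[cite: MageeOhWinter2019, §2.2] -/
def cfLC (s : ℂ) (f : ℝ → ℂ) (x : ℝ) : ℂ :=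
  ∑ a ∈ A, cfWt s (cfGen a) x * f (1 / (x + a))

variable (A) in
/-- The word sums `Σ_{w ∈ Aⁿ} denom(M_w, x)^{-2s} f(M_w x)`. [folklore] -/
def cfLCSum (s : ℂ) (n : ℕ) (f : ℝ → ℂ) (x : ℝ) : ℂ :=
  ∑ w : Fin n → A, cfWt s (cfMat fun i => (w i : ℕ)) x * f (cfMoeb (cfMat fun i => (w i : ℕ)) x)

/-- `W_0 f = f`. [folklore] -/
theorem cfLCSum_zero (s : ℂ) (f : ℝ → ℂ) (x : ℝ) : cfLCSum A s 0 f x = f x := by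
  simp [cfLCSum, cfWt, cfDenom, cfMoeb, cfMat]

/-- **The iterates of `L_s` are word sums** on `[0,1]`. [cite: MageeOhWinter2019, §2.2] -/
theorem cfLC_iterate (hA : ∀ a ∈ A, 1 ≤ a) (s : ℂ) (f : ℝ → ℂ) :
    ∀ (n : ℕ) {x : ℝ}, x ∈ Icc (0 : ℝ) 1 → (cfLC A s)^[n] f x = cfLCSum A s n f x
  | 0, x, _ => by rw [Function.iterate_zero, id, cfLCSum_zero]
  | n + 1, x, hx => by
      rw [Function.iterate_succ_apply', cfLC,
        Finset.sum_congr rfl fun a ha => by rw [cfLC_iterate hA s f n (one_div_add_mem_Icc (hA a ha) hx)]]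
      rw [cfLCSum, ← (Fin.appendEquiv n 1).sum_comp, Fintype.sum_prod_type, Finset.sum_comm,
        ← Finset.sum_coe_sort A, ← (Equiv.funUnique (Fin 1) A).sum_comp]
      refine Finset.sum_congr rfl fun v _ => ?_
      rw [cfLCSum, Finset.mul_sum]
      refine Finset.sum_congr rfl fun w _ => ?_
      simp only [Fin.appendEquiv_apply, Equiv.funUnique_apply, Fin.default_eq_zero]
      rw [coe_append, cfMat_append, cfMat_fin_one]
      have hw : ∀ i, 1 ≤ (fun i => (w i : ℕ)) i := one_le_coe_digit hA w
      have hxa : 0 < cfDenom (cfGen ((v 0 : A) : ℕ)) x := by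
        rw [cfDenom_cfGen]
        have ha1 : (1 : ℝ) ≤ ((v 0 : A) : ℕ) := by exact_mod_cast hA _ (v 0).2
        linarith [hx.1]
      have hy : cfMoeb (cfGen ((v 0 : A) : ℕ)) x ∈ Icc (0 : ℝ) 1 := by
        rw [cfMoeb_cfGen]
        exact one_div_add_mem_Icc (hA _ (v 0).2) hx
      have hM : 0 < cfDenom (cfMat fun i => (w i : ℕ)) (cfMoeb (cfGen ((v 0 : A) : ℕ)) x) :=
        cfDenom_cfMat_pos hw hy
      rw [cfWt_mul s _ _ hxa hM, cfMoeb_mul _ _ hxa.ne' hM.ne', cfMoeb_cfGen]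
      ring

/-- The word sums only see the values on `[0,1]`. [folklore] -/
theorem cfLCSum_congr (hA : ∀ a ∈ A, 1 ≤ a) (s : ℂ) (n : ℕ) {g g' : ℝ → ℂ}
    (h : ∀ y ∈ Icc (0 : ℝ) 1, g y = g' y) {x : ℝ} (hx : x ∈ Icc (0 : ℝ) 1) :
    cfLCSum A s n g x = cfLCSum A s n g' x := by
  unfold cfLCSum
  exact Finset.sum_congr rfl fun w _ => by rw [h _ (cfMoeb_cfMat_mem (one_le_coe_digit hA w) hx)]

/-- The iterates only see the values on `[0,1]`. [folklore] -/
theorem cfLC_iterate_congr (hA : ∀ a ∈ A, 1 ≤ a) (s : ℂ) (n : ℕ) {g g' : ℝ → ℂ}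
    (h : ∀ y ∈ Icc (0 : ℝ) 1, g y = g' y) {x : ℝ} (hx : x ∈ Icc (0 : ℝ) 1) :
    (cfLC A s)^[n] g x = (cfLC A s)^[n] g' x := by
  rw [cfLC_iterate hA s g n hx, cfLC_iterate hA s g' n hx, cfLCSum_congr hA s n h hx]

/-- Additivity of the iterates on `[0,1]`. [folklore] -/
theorem cfLC_iterate_add (hA : ∀ a ∈ A, 1 ≤ a) (s : ℂ) (n : ℕ) (g g' : ℝ → ℂ) {x : ℝ}
    (hx : x ∈ Icc (0 : ℝ) 1) :
    (cfLC A s)^[n] (fun y => g y + g' y) x = (cfLC A s)^[n] g x + (cfLC A s)^[n] g' x := by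
  rw [cfLC_iterate hA s _ n hx, cfLC_iterate hA s g n hx, cfLC_iterate hA s g' n hx]
  simp only [cfLCSum, mul_add, Finset.sum_add_distrib]

/-- Homogeneity of the iterates on `[0,1]`. [folklore] -/
theorem cfLC_iterate_const_mul (hA : ∀ a ∈ A, 1 ≤ a) (s : ℂ) (n : ℕ) (c : ℂ) (g : ℝ → ℂ)
    {x : ℝ} (hx : x ∈ Icc (0 : ℝ) 1) :
    (cfLC A s)^[n] (fun y => c * g y) x = c * (cfLC A s)^[n] g x := by
  rw [cfLC_iterate hA s _ n hx, cfLC_iterate hA s g n hx]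
  simp only [cfLCSum, Finset.mul_sum]
  exact Finset.sum_congr rfl fun w _ => by ring

/-! ### Compatibility with the real transfer operator -/

/-- For real `s` and real `f`, the complex word sums are the real ones. [folklore] -/
theorem cfLCSum_ofReal (hA : ∀ a ∈ A, 1 ≤ a) (σ : ℝ) (n : ℕ) (g : ℝ → ℝ) {x : ℝ}
    (hx : x ∈ Icc (0 : ℝ) 1) :
    cfLCSum A (σ : ℂ) n (fun y => (g y : ℂ)) x = ((cfTransferSum A σ n g x : ℝ) : ℂ) := by
  rw [cfLCSum, cfTransferSum, Complex.ofReal_sum]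
  refine Finset.sum_congr rfl fun w _ => ?_
  rw [cfWt_ofReal σ _ (cfDenom_cfMat_pos (one_le_coe_digit hA w) hx), Complex.ofReal_mul]

/-- **For real `s` and real `f`, `L_sⁿ` is the real transfer operator.** [folklore] -/
theorem cfLC_iterate_ofReal (hA : ∀ a ∈ A, 1 ≤ a) (σ : ℝ) (n : ℕ) (g : ℝ → ℝ) {x : ℝ}
    (hx : x ∈ Icc (0 : ℝ) 1) :
    (cfLC A (σ : ℂ))^[n] (fun y => (g y : ℂ)) x = (((cfTransfer A σ)^[n] g x : ℝ) : ℂ) := by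
  rw [cfLC_iterate hA _ _ n hx, cfTransfer_iterate hA σ g n hx, cfLCSum_ofReal hA σ n g hx]

/-- In particular `L_s` itself (`n = 1`). [folklore] -/
theorem cfLC_ofReal (hA : ∀ a ∈ A, 1 ≤ a) (σ : ℝ) (g : ℝ → ℝ) {x : ℝ} (hx : x ∈ Icc (0 : ℝ) 1) :
    cfLC A (σ : ℂ) (fun y => (g y : ℂ)) x = ((cfTransfer A σ g x : ℝ) : ℂ) := by
  simpa using cfLC_iterate_ofReal hA σ 1 g hx

/-! ### Domination by the real operator `L_{Re s}` -/

/-- **Domination of the word sums:** `‖Σ_w wt_s f(M_w x)‖ ≤ Σ_w (denom²)^{-Re s} ‖f(M_w x)‖`.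
[cite: MageeOhWinter2019, §3.3] -/
theorem norm_cfLCSum_le (hA : ∀ a ∈ A, 1 ≤ a) (s : ℂ) (n : ℕ) (f : ℝ → ℂ) {x : ℝ}
    (hx : x ∈ Icc (0 : ℝ) 1) :
    ‖cfLCSum A s n f x‖ ≤ cfTransferSum A s.re n (fun y => ‖f y‖) x := by
  rw [cfLCSum, cfTransferSum]
  refine (norm_sum_le _ _).trans (le_of_eq (Finset.sum_congr rfl fun w _ => ?_))
  rw [norm_mul, norm_cfWt s _ (cfDenom_cfMat_pos (one_le_coe_digit hA w) hx)]

/-- **Domination of the iterates:** `‖L_sⁿ f (x)‖ ≤ (L_{Re s}ⁿ ‖f‖)(x)` on `[0,1]`.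
[cite: MageeOhWinter2019, §3.3] -/
theorem norm_cfLC_iterate_le (hA : ∀ a ∈ A, 1 ≤ a) (s : ℂ) (n : ℕ) (f : ℝ → ℂ) {x : ℝ}
    (hx : x ∈ Icc (0 : ℝ) 1) :
    ‖(cfLC A s)^[n] f x‖ ≤ (cfTransfer A s.re)^[n] (fun y => ‖f y‖) x := by
  rw [cfLC_iterate hA s f n hx, cfTransfer_iterate hA s.re _ n hx]
  exact norm_cfLCSum_le hA s n f hx

/-- **Uniform bound:** if `‖f‖ ≤ M` on `[0,1]` then `‖L_sⁿ f (x)‖ ≤ M (L_{Re s}ⁿ 1)(x)` on `[0,1]`.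
[folklore] -/
theorem norm_cfLC_iterate_le_mul (hA : ∀ a ∈ A, 1 ≤ a) (s : ℂ) (n : ℕ) {f : ℝ → ℂ} {M : ℝ}
    (hf : ∀ y ∈ Icc (0 : ℝ) 1, ‖f y‖ ≤ M) {x : ℝ} (hx : x ∈ Icc (0 : ℝ) 1) :
    ‖(cfLC A s)^[n] f x‖ ≤ M * (cfTransfer A s.re)^[n] (fun _ => 1) x := by
  rw [cfLC_iterate hA s f n hx, cfTransfer_iterate hA s.re _ n hx]
  refine (norm_cfLCSum_le hA s n f hx).trans ?_
  rw [cfTransferSum, cfTransferSum, Finset.mul_sum]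
  refine Finset.sum_le_sum fun w _ => ?_
  rw [mul_one, mul_comm]
  exact mul_le_mul_of_nonneg_right (hf _ (cfMoeb_cfMat_mem (one_le_coe_digit hA w) hx))
    (Real.rpow_nonneg (sq_nonneg _) _)

/-- **Growth bound:** `‖L_sⁿ f (x)‖ ≤ M 4^{σ} e^{n P_A(σ)}` for `σ = Re s ≥ 0`, `‖f‖ ≤ M` on `[0,1]`.
[cite: MageeOhWinter2019, §3.3] -/
theorem norm_cfLC_iterate_le_of_bound (hA : ∀ a ∈ A, 1 ≤ a) (hne : A.Nonempty) {s : ℂ}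
    (hs : 0 ≤ s.re) (n : ℕ) {f : ℝ → ℂ} {M : ℝ} (hM : 0 ≤ M) (hf : ∀ y ∈ Icc (0 : ℝ) 1, ‖f y‖ ≤ M)
    {x : ℝ} (hx : x ∈ Icc (0 : ℝ) 1) :
    ‖(cfLC A s)^[n] f x‖ ≤ M * ((4 : ℝ) ^ s.re * cfEig A s.re ^ n) := by
  refine (norm_cfLC_iterate_le_mul hA s n hf hx).trans (mul_le_mul_of_nonneg_left ?_ hM)
  have h := (cfTransfer_iterate_one_div_mem hA hne hs n hx).2
  rwa [div_le_iff₀ (pow_pos (cfEig_pos _) n)] at h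

/-! ### Bounded distortion of the complex weights -/

/-- **Distortion of the complex weights:** for `w ∈ Aⁿ`, `x, y ∈ [0,1]`, `Re s ≥ 0`:
`‖wt_s(M_w, x) - wt_s(M_w, y)‖ ≤ (denom(M_w,y)²)^{-Re s} · 2‖s‖ e^{2‖s‖ |x-y|} |x - y|`, from
`|log denom(M_w, x) - log denom(M_w, y)| ≤ |x - y|`. [cite: MageeOhWinter2019, §2.1 eq. (2.1)] -/
theorem norm_cfWt_sub_cfWt_le {w : Fin n → ℕ} (hw : ∀ i, 1 ≤ w i) (s : ℂ) {x y : ℝ}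
    (hx : x ∈ Icc (0 : ℝ) 1) (hy : y ∈ Icc (0 : ℝ) 1) :
    ‖cfWt s (cfMat w) x - cfWt s (cfMat w) y‖ ≤
      ((cfDenom (cfMat w) y) ^ 2) ^ (-s.re) * (2 * ‖s‖ * Real.exp (2 * ‖s‖ * |x - y|) * |x - y|) := by
  have hdx := cfDenom_cfMat_pos hw hx
  have hdy := cfDenom_cfMat_pos hw hy
  -- `|log d(x) - log d(y)| ≤ |x - y|`
  have hlog : |Real.log (cfDenom (cfMat w) x) - Real.log (cfDenom (cfMat w) y)| ≤ |x - y| := by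
    have h1 := cfDenom_le_exp_mul hw hy x   -- d x ≤ e^{|y-x|} d y
    have h2 := cfDenom_le_exp_mul hw hx y   -- d y ≤ e^{|x-y|} d x
    rw [abs_sub_comm] at h1
    have l1 := Real.log_le_log hdx h1
    have l2 := Real.log_le_log hdy h2
    rw [Real.log_mul (Real.exp_pos _).ne' hdy.ne', Real.log_exp] at l1
    rw [Real.log_mul (Real.exp_pos _).ne' hdx.ne', Real.log_exp] at l2
    rw [abs_le]; constructor <;> linarith
  -- factor `wt(x) - wt(y) = wt(y) (exp(-2s Δ) - 1)`
  set Δ : ℝ := Real.log (cfDenom (cfMat w) x) - Real.log (cfDenom (cfMat w) y) with hΔ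
  have hfac : cfWt s (cfMat w) x - cfWt s (cfMat w) y =
      cfWt s (cfMat w) y * (Complex.exp (-(2 * s * (Δ : ℂ))) - 1) := by
    rw [mul_sub, mul_one, cfWt, cfWt, ← Complex.exp_add]
    congr 2
    rw [hΔ]; push_cast; ring
  rw [hfac, norm_mul, norm_cfWt s _ hdy]
  refine mul_le_mul_of_nonneg_left ?_ (Real.rpow_nonneg (sq_nonneg _) _)
  have hz : ‖(-(2 * s * (Δ : ℂ)))‖ = 2 * ‖s‖ * |Δ| := by
    rw [norm_neg, norm_mul, norm_mul, Complex.norm_real, Real.norm_eq_abs]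
    norm_num
  -- `‖e^z - 1‖ ≤ ‖z‖ e^{‖z‖}` (Mathlib, `Complex.norm_exp_sub_sum_le_norm_mul_exp` with one term)
  have hbd : ‖Complex.exp (-(2 * s * (Δ : ℂ))) - 1‖ ≤
      ‖(-(2 * s * (Δ : ℂ)))‖ * Real.exp ‖(-(2 * s * (Δ : ℂ)))‖ := by
    have h := Complex.norm_exp_sub_sum_le_norm_mul_exp (-(2 * s * (Δ : ℂ))) 1
    simp only [Finset.range_one, Finset.sum_singleton, pow_zero, Nat.factorial_zero, Nat.cast_one,
      div_one, pow_one] at h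
    exact h
  refine hbd.trans ?_
  rw [hz]
  have hΔ1 : |Δ| ≤ |x - y| := hlog
  have hs0 : 0 ≤ 2 * ‖s‖ := by positivity
  have hexp : Real.exp (2 * ‖s‖ * |Δ|) ≤ Real.exp (2 * ‖s‖ * |x - y|) :=
    Real.exp_le_exp.2 (mul_le_mul_of_nonneg_left hΔ1 hs0)
  calc 2 * ‖s‖ * |Δ| * Real.exp (2 * ‖s‖ * |Δ|) ≤ 2 * ‖s‖ * |x - y| * Real.exp (2 * ‖s‖ * |x - y|) :=
        mul_le_mul (mul_le_mul_of_nonneg_left hΔ1 hs0) hexp (Real.exp_pos _).le (by positivity)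
    _ = 2 * ‖s‖ * Real.exp (2 * ‖s‖ * |x - y|) * |x - y| := by ring

/-! ### The Lasota–Yorke inequality -/

/-- **Lasota–Yorke inequality for `L_sⁿ`** ([MageeOhWinter2019, §3.3]; Naud, Prop. 5.x): if
`‖f‖ ≤ M` and `‖f(x) - f(y)‖ ≤ L|x - y|` on `[0,1]` (`M, L ≥ 0`), then for `x, y ∈ [0,1]`,
`‖L_sⁿ f (x) - L_sⁿ f (y)‖ ≤ (L_{Re s}ⁿ 1)(y) · (2‖s‖ e^{2‖s‖} M + 2^{1-n} L) · |x - y|`.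
[cite: MageeOhWinter2019, §3.3] -/
theorem norm_cfLC_iterate_sub_le (hA : ∀ a ∈ A, 1 ≤ a) (s : ℂ) (n : ℕ) {f : ℝ → ℂ} {M L : ℝ}
    (hM0 : 0 ≤ M) (hL0 : 0 ≤ L) (hM : ∀ y ∈ Icc (0 : ℝ) 1, ‖f y‖ ≤ M)
    (hL : ∀ x ∈ Icc (0 : ℝ) 1, ∀ y ∈ Icc (0 : ℝ) 1, ‖f x - f y‖ ≤ L * |x - y|) {x y : ℝ}
    (hx : x ∈ Icc (0 : ℝ) 1) (hy : y ∈ Icc (0 : ℝ) 1) :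
    ‖(cfLC A s)^[n] f x - (cfLC A s)^[n] f y‖ ≤
      (cfTransfer A s.re)^[n] (fun _ => 1) y *
        ((2 * ‖s‖ * Real.exp (2 * ‖s‖) * M + (1 / 2 : ℝ) ^ (n - 1) * L) * |x - y|) := by
  rw [cfLC_iterate hA s f n hx, cfLC_iterate hA s f n hy, cfTransfer_iterate hA s.re _ n hy,
    cfLCSum, cfLCSum, ← Finset.sum_sub_distrib, cfTransferSum, Finset.sum_mul]
  refine (norm_sum_le _ _).trans (Finset.sum_le_sum fun w _ => ?_)
  have hw : ∀ i, 1 ≤ (fun i => (w i : ℕ)) i := one_le_coe_digit hA w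
  set Mw := cfMat fun i => (w i : ℕ) with hMw
  have hdy := cfDenom_cfMat_pos hw hy
  have hux := cfMoeb_cfMat_mem hw hx
  have huy := cfMoeb_cfMat_mem hw hy
  have hd1 : |x - y| ≤ 1 := by rw [abs_le]; constructor <;> linarith [hx.1, hx.2, hy.1, hy.2]
  have hd0 : 0 ≤ |x - y| := abs_nonneg _
  -- split `wt(x) f(u) - wt(y) f(v) = (wt(x) - wt(y)) f(u) + wt(y) (f(u) - f(v))`
  have hsplit : cfWt s Mw x * f (cfMoeb Mw x) - cfWt s Mw y * f (cfMoeb Mw y) =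
      (cfWt s Mw x - cfWt s Mw y) * f (cfMoeb Mw x) + cfWt s Mw y * (f (cfMoeb Mw x) - f (cfMoeb Mw y)) := by
    ring
  rw [hsplit, mul_one]
  have hwt : ‖cfWt s Mw y‖ = ((cfDenom Mw y) ^ 2) ^ (-s.re) := norm_cfWt s _ hdy
  have hpos : 0 ≤ ((cfDenom Mw y) ^ 2) ^ (-s.re) := Real.rpow_nonneg (sq_nonneg _) _
  -- first term
  have h1 : ‖(cfWt s Mw x - cfWt s Mw y) * f (cfMoeb Mw x)‖ ≤
      ((cfDenom Mw y) ^ 2) ^ (-s.re) * (2 * ‖s‖ * Real.exp (2 * ‖s‖) * M * |x - y|) := by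
    rw [norm_mul]
    have hwd := norm_cfWt_sub_cfWt_le hw s hx hy
    have hexp : Real.exp (2 * ‖s‖ * |x - y|) ≤ Real.exp (2 * ‖s‖) :=
      Real.exp_le_exp.2 (by nlinarith [norm_nonneg s])
    calc ‖cfWt s Mw x - cfWt s Mw y‖ * ‖f (cfMoeb Mw x)‖
        ≤ ((cfDenom Mw y) ^ 2) ^ (-s.re) * (2 * ‖s‖ * Real.exp (2 * ‖s‖ * |x - y|) * |x - y|) * M :=
          mul_le_mul hwd (hM _ hux) (norm_nonneg _) (by positivity)
      _ ≤ ((cfDenom Mw y) ^ 2) ^ (-s.re) * (2 * ‖s‖ * Real.exp (2 * ‖s‖) * |x - y|) * M := by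
          gcongr
      _ = _ := by ring
  -- second term
  have h2 : ‖cfWt s Mw y * (f (cfMoeb Mw x) - f (cfMoeb Mw y))‖ ≤
      ((cfDenom Mw y) ^ 2) ^ (-s.re) * ((1 / 2 : ℝ) ^ (n - 1) * L * |x - y|) := by
    rw [norm_mul, hwt]
    refine mul_le_mul_of_nonneg_left ?_ hpos
    calc ‖f (cfMoeb Mw x) - f (cfMoeb Mw y)‖ ≤ L * |cfMoeb Mw x - cfMoeb Mw y| := hL _ hux _ huy
      _ ≤ L * ((1 / 2 : ℝ) ^ (n - 1) * |x - y|) :=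
          mul_le_mul_of_nonneg_left (abs_cfMoeb_sub_le_geom hw hx hy) hL0
      _ = (1 / 2 : ℝ) ^ (n - 1) * L * |x - y| := by ring
  calc ‖(cfWt s Mw x - cfWt s Mw y) * f (cfMoeb Mw x) + cfWt s Mw y * (f (cfMoeb Mw x) - f (cfMoeb Mw y))‖
      ≤ ‖(cfWt s Mw x - cfWt s Mw y) * f (cfMoeb Mw x)‖ + ‖cfWt s Mw y * (f (cfMoeb Mw x) - f (cfMoeb Mw y))‖ :=
        norm_add_le _ _
    _ ≤ ((cfDenom Mw y) ^ 2) ^ (-s.re) * (2 * ‖s‖ * Real.exp (2 * ‖s‖) * M * |x - y|) +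
        ((cfDenom Mw y) ^ 2) ^ (-s.re) * ((1 / 2 : ℝ) ^ (n - 1) * L * |x - y|) := add_le_add h1 h2
    _ = ((cfDenom Mw y) ^ 2) ^ (-s.re) *
        ((2 * ‖s‖ * Real.exp (2 * ‖s‖) * M + (1 / 2 : ℝ) ^ (n - 1) * L) * |x - y|) := by ring

/-- **Lasota–Yorke inequality, growth form:** with `σ = Re s ≥ 0`,
`‖L_sⁿ f (x) - L_sⁿ f (y)‖ ≤ 4^σ e^{nP_A(σ)} (2‖s‖e^{2‖s‖} M + 2^{1-n} L) |x - y|` on `[0,1]`.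
[cite: MageeOhWinter2019, §3.3] -/
theorem norm_cfLC_iterate_sub_le' (hA : ∀ a ∈ A, 1 ≤ a) (hne : A.Nonempty) {s : ℂ} (hs : 0 ≤ s.re)
    (n : ℕ) {f : ℝ → ℂ} {M L : ℝ} (hM0 : 0 ≤ M) (hL0 : 0 ≤ L) (hM : ∀ y ∈ Icc (0 : ℝ) 1, ‖f y‖ ≤ M)
    (hL : ∀ x ∈ Icc (0 : ℝ) 1, ∀ y ∈ Icc (0 : ℝ) 1, ‖f x - f y‖ ≤ L * |x - y|) {x y : ℝ}
    (hx : x ∈ Icc (0 : ℝ) 1) (hy : y ∈ Icc (0 : ℝ) 1) :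
    ‖(cfLC A s)^[n] f x - (cfLC A s)^[n] f y‖ ≤
      (4 : ℝ) ^ s.re * cfEig A s.re ^ n *
        ((2 * ‖s‖ * Real.exp (2 * ‖s‖) * M + (1 / 2 : ℝ) ^ (n - 1) * L) * |x - y|) := by
  refine (norm_cfLC_iterate_sub_le hA s n hM0 hL0 hM hL hx hy).trans
    (mul_le_mul_of_nonneg_right ?_ (by positivity))
  have h := (cfTransfer_iterate_one_div_mem hA hne hs n hy).2
  rwa [div_le_iff₀ (pow_pos (cfEig_pos _) n)] at h

/-! ### Holomorphy in `s` -/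

variable (A) in
/-- The `s`-derivative word sums `Σ_w (-2 log denom(M_w, x)) denom(M_w,x)^{-2s} f(M_w x)`.
[folklore] -/
def cfLCSumD (s : ℂ) (n : ℕ) (f : ℝ → ℂ) (x : ℝ) : ℂ :=
  ∑ w : Fin n → A, (-(2 * (Real.log (cfDenom (cfMat fun i => (w i : ℕ)) x) : ℂ))) *
    (cfWt s (cfMat fun i => (w i : ℕ)) x * f (cfMoeb (cfMat fun i => (w i : ℕ)) x))

/-- The weight is entire in `s` with derivative `-2 log denom · wt`. [folklore] -/
theorem hasDerivAt_cfWt (M : Matrix (Fin 2) (Fin 2) ℤ) (x : ℝ) (s : ℂ) :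
    HasDerivAt (fun s => cfWt s M x) (-(2 * (Real.log (cfDenom M x) : ℂ)) * cfWt s M x) s := by
  unfold cfWt
  have h : HasDerivAt (fun s : ℂ => -(2 * s * (Real.log (cfDenom M x) : ℂ)))
      (-(2 * (Real.log (cfDenom M x) : ℂ))) s := by
    have h1 : HasDerivAt (fun s : ℂ => 2 * s * (Real.log (cfDenom M x) : ℂ))
        (2 * 1 * (Real.log (cfDenom M x) : ℂ)) s :=
      ((hasDerivAt_id' s).const_mul (2 : ℂ)).mul_const (Real.log (cfDenom M x) : ℂ)
    rw [mul_one] at h1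
    exact h1.neg
  have h2 := h.cexp
  rw [mul_comm] at h2
  exact h2

/-- **`s ↦ L_sⁿ f (x)` is entire:** the word sum has derivative `cfLCSumD`.
[cite: MageeOhWinter2019, §3.4] -/
theorem hasDerivAt_cfLCSum (s : ℂ) (n : ℕ) (f : ℝ → ℂ) (x : ℝ) :
    HasDerivAt (fun s => cfLCSum A s n f x) (cfLCSumD A s n f x) s := by
  unfold cfLCSum cfLCSumD
  refine HasDerivAt.fun_sum fun w _ => ?_
  have h := (hasDerivAt_cfWt (cfMat fun i => (w i : ℕ)) x s).mul_const
    (f (cfMoeb (cfMat fun i => (w i : ℕ)) x))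
  rwa [mul_assoc] at h

/-- `s ↦ L_sⁿ f (x)` is differentiable (entire). [folklore] -/
theorem differentiable_cfLCSum (n : ℕ) (f : ℝ → ℂ) (x : ℝ) :
    Differentiable ℂ fun s => cfLCSum A s n f x :=
  fun s => (hasDerivAt_cfLCSum s n f x).differentiableAt

/-- `s ↦ L_sⁿ f (x)` is continuous. [folklore] -/
theorem continuous_cfLCSum (n : ℕ) (f : ℝ → ℂ) (x : ℝ) : Continuous fun s => cfLCSum A s n f x :=
  (differentiable_cfLCSum n f x).continuous

/-- Domination of the derivative word sums: `‖Σ_w (-2 log d_w) wt f‖ ≤ 2 log(2^{n}) ...`; precisely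
`‖cfLCSumD‖ ≤ 2 (n log (B+1) + log 2) (L_{Re s}ⁿ ‖f‖)(x)` where `B` bounds the digits, from
`1 ≤ denom(M_w, x) ≤ 2 q(w) ≤ 2 (B+1)ⁿ`. [folklore] -/
theorem norm_cfLCSumD_le (hA : ∀ a ∈ A, 1 ≤ a) {B : ℕ} (hB : ∀ a ∈ A, a ≤ B) (s : ℂ) (n : ℕ)
    (f : ℝ → ℂ) {x : ℝ} (hx : x ∈ Icc (0 : ℝ) 1) :
    ‖cfLCSumD A s n f x‖ ≤ 2 * (n * Real.log (B + 1) + Real.log 2) *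
      cfTransferSum A s.re n (fun y => ‖f y‖) x := by
  rw [cfLCSumD, cfTransferSum, Finset.mul_sum]
  refine (norm_sum_le _ _).trans (Finset.sum_le_sum fun w _ => ?_)
  have hw : ∀ i, 1 ≤ (fun i => (w i : ℕ)) i := one_le_coe_digit hA w
  have hd := cfDenom_cfMat_pos hw hx
  have hmem := cfDenom_cfMat_mem hw hx
  have hq1 : (1 : ℝ) ≤ (cfQ fun i => (w i : ℕ) : ℝ) := by exact_mod_cast one_le_cfQ hw
  have hqB : ((cfQ fun i => (w i : ℕ) : ℤ) : ℝ) ≤ ((B : ℝ) + 1) ^ n := by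
    have h := cfQ_le_pow hw (B := B) fun i => hB _ (w i).2
    exact_mod_cast h
  have hd1 : 1 ≤ cfDenom (cfMat fun i => (w i : ℕ)) x := hq1.trans hmem.1
  have hd2 : cfDenom (cfMat fun i => (w i : ℕ)) x ≤ 2 * ((B : ℝ) + 1) ^ n := by
    linarith [hmem.2]
  have hlog0 : 0 ≤ Real.log (cfDenom (cfMat fun i => (w i : ℕ)) x) := Real.log_nonneg hd1
  have hlog : Real.log (cfDenom (cfMat fun i => (w i : ℕ)) x) ≤ n * Real.log (B + 1) + Real.log 2 := by
    have h := Real.log_le_log hd hd2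
    rw [Real.log_mul (by norm_num) (by positivity), Real.log_pow] at h
    linarith
  rw [norm_mul, norm_mul, norm_cfWt s _ hd, norm_neg, norm_mul, Complex.norm_real,
    Real.norm_eq_abs, abs_of_nonneg hlog0]
  have h2 : ‖(2 : ℂ)‖ = 2 := by norm_num
  rw [h2]
  have hwt : 0 ≤ ((cfDenom (cfMat fun i => (w i : ℕ)) x) ^ 2) ^ (-s.re) * ‖f (cfMoeb (cfMat fun i => (w i : ℕ)) x)‖ :=
    mul_nonneg (Real.rpow_nonneg (sq_nonneg _) _) (norm_nonneg _)
  calc 2 * Real.log (cfDenom (cfMat fun i => (w i : ℕ)) x) *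
        (((cfDenom (cfMat fun i => (w i : ℕ)) x) ^ 2) ^ (-s.re) * ‖f (cfMoeb (cfMat fun i => (w i : ℕ)) x)‖)
      ≤ 2 * (n * Real.log (B + 1) + Real.log 2) *
        (((cfDenom (cfMat fun i => (w i : ℕ)) x) ^ 2) ^ (-s.re) * ‖f (cfMoeb (cfMat fun i => (w i : ℕ)) x)‖) := by
        gcongr

end Literature.NumberTheory.Sieve
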